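import Summits.Ventures.CertifiedManyBodySolver.Observables.StiffnessThermalKineticHook
import Literature.MathematicalPhysics.QuantumLattice.TorusSectorGibbsEnergyWindow
import Literature.MathematicalPhysics.QuantumLattice.XYMessagerMiracleSole
import Literature.MathematicalPhysics.QuantumLattice.TorusSectorGibbsScaleCovariance
import Literature.MathematicalPhysics.QuantumLattice.TorusLimitOfMixturesCompactness
import Summits.HubbardSuperconductivity.HubbardLadder.Bounds.ThermalMottStiffnessCeiling
import HarnessLib

/-!
# Bridge: the thermal kinetic hook in the TORUS-LIMIT THERMAL CONVENTION (`szConfig` / `sectorHamiltonianTT'`)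

HONEST FRAMING: ladder R1–R4 with certified numbers; no claim on H/H₀. Cell `pub/hubbard-tc` (MO-S3 ORDER → T_c back-end), seat
`hubbard-tc-mod-2` (KT back-end; crux №3 «ROUTE T-A», HOME/hubbard-tc-mod-2/KT-THERMAL-INTERFACE.md §1b). Companion of
`StiffnessThermalKineticHook.lean` (p468397 + p471722): the same hook, its hypothesis re-expressed in the vocabulary of sr-mbsolver/hubbard-thermal's
`T > 0` certificate framework (`TorusSectorGibbsMixture` / `TorusSectorGibbsEnergyWindow`: canonical sector `szConfig n L`, compressed Hamiltonian
`sectorHamiltonianTT' t t′ U n L`), so that their reader's output plugs in with no glue on the predicate / block side.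

WHAT THIS IS NOT: not a T_c of any material; not a thermal certificate; not a theorem that the Hubbard model has a Kosterlitz–Thouless transition.
Pure bookkeeping: two names for one sector, and the reindex-invariance of the Gibbs state.

* `sectorPred_iff_szConfig` — the hook's sector predicate (the binder of `thermalFluxLogZ`) is pointwise equivalent to `szConfig n L` (spin-0 count =
  `#upPart`: pub-hubbard's `Bounds.card_filter_spin_zero_eq_card_upPart`, REUSED);
* `gibbsState_sectorHamiltonianTT'_eq_toBlock` — every Gibbs expectation of the canonical sector agrees in the two vocabularies (blocks are
  `Matrix.reindex`-related along `Equiv.subtypeEquivRight`, and `gibbsState_reindex`);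
* `ObsThermalStiffnessSeqCeilingAtBeta_of_sectorGibbs_kinetic_eventually_add` / `…_subseq_add` — the `limsup` / subsequence hooks with the kinetic
  ceiling stated on `gibbsState β (sectorHamiltonianTT' 1 t′ U n L) ((kinOpTT' L t′).submatrix val val)`;
* `ThermalKTDictionaryAt.le_inv_of_sectorGibbs_kinetic_eventually_add` / `…_subseq_add` (`Tc ≤ 1/β`) and the `(8, ⅞, 0)`, `β = 4` row form
  `le_quarter_of_sectorGibbs_kinetic_eventually_add_four` (`c < 0.3183098 ⇒ Tc ≤ 1/4`).

References: ParamekantiTrivediRanderia1998 eq. (3), §IV; HazraVermaRanderia2019 eqs. (2)–(4); Israel1979 §I.3 eq. (26); LiebPRL1989.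
-/

noncomputable section

namespace Summit.Ventures.CertifiedManyBodySolver.Observables

open Filter Topology Set Real Matrix
open Literature.MathematicalPhysics.QuantumLattice
open Literature.MathematicalPhysics.QuantumFieldTheory
open Literature.MathematicalPhysics.StatisticalMechanics
open Literature.MathematicalPhysics.StatisticalMechanics.KosterlitzThouless
open Summit.HubbardSuperconductivity.HubbardLadder.Bounds
open scoped ComplexConjugate ComplexOrder

/-! ## The two names of the canonical sector

hubbard-thermal's `T > 0` framework (`TorusSectorGibbsMixture`, `TorusSectorGibbsEnergyWindow`) names the canonical sector by the predicate
`szConfig n L s` (`#↑ = #↓ = ⌊nL²/2⌋`) and the compressed Hamiltonian `sectorHamiltonianTT' t t′ U n L = (hubbardTorusTT' L t t′ U).submatrix val val`;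
the kinetic hook (`StiffnessThermalKineticHook`) names the SAME sector by the binder of `thermalFluxLogZ` (`#s = 2⌊(1−(1−n))L²/2⌋ ∧ 2·#{spin 0} = 2⌊(1−(1−n))L²/2⌋`) and `Matrix.toBlock`.
The two predicates are pointwise equivalent (`sectorPred_iff_szConfig`), the blocks are `Matrix.reindex`-related along `Equiv.subtypeEquivRight`, and the
Gibbs state is reindex-invariant (`gibbsState_reindex`), so every Gibbs expectation agrees (`gibbsState_sectorHamiltonianTT'_eq_toBlock`). Hence the hook in
THEIR vocabulary: `ObsThermalStiffnessSeqCeilingAtBeta_of_sectorGibbs_kinetic_eventually_add` / `…_subseq_add`, the closure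
`ThermalKTDictionaryAt.le_inv_of_sectorGibbs_kinetic_eventually_add` and the `(8, ⅞, 0)`, `β = 4` row form — what remains on the producer side is only
(A) mixture compactness and (B) eigen-mixture `Σ_i p_i⟨ψ_i, X ψ_i⟩ = Re gibbsState β (sectorHamiltonianTT' …) (X.submatrix val val)`.
-/

/-- **The hook's sector predicate IS hubbard-thermal's `szConfig n L`**: `#s = 2⌊(1−(1−n))L²/2⌋ ∧ 2·#{spin-0 orbitals of s} = 2⌊(1−(1−n))L²/2⌋`
iff `#↑(s) = #↓(s) = halfRectN n L = ⌊nL²/2⌋`. [cite: LiebPRL1989, proof of Theorem 1] -/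
theorem sectorPred_iff_szConfig (n : ℝ) (L : ℕ) (s : Finset (Orb (FermionTorus 2 L))) :
    (s.card = 2 * ⌊(1 - (1 - n)) * (L : ℝ) ^ 2 / 2⌋₊ ∧
        2 * (s.filter fun i => (ofLex i).2 = 0).card = 2 * ⌊(1 - (1 - n)) * (L : ℝ) ^ 2 / 2⌋₊) ↔
      szConfig n L s := by
  have h1 : ⌊(1 - (1 - n)) * (L : ℝ) ^ 2 / 2⌋₊ = halfRectN n L := by rw [sub_sub_cancel]; rfl
  rw [h1, card_filter_spin_zero_eq_card_upPart, card_eq_upPart_add_downPart s, szConfig]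
  omega

/-- **Every Gibbs expectation of the canonical sector agrees in the two vocabularies**: for any observable `X` of the torus,
`⟨X|_szConfig⟩` in the Gibbs state of `sectorHamiltonianTT' 1 t′ U n L` equals `⟨X.toBlock p p⟩` in the Gibbs state of `(hubbardTorusTT' L 1 t′ U).toBlock p p`,
`p` the hook's predicate — the blocks are `Matrix.reindex`es of each other along `Equiv.subtypeEquivRight sectorPred_iff_szConfig` and the Gibbs state is
reindex-invariant. [cite: Israel1979, §I.3 eq. (26)] -/
theorem gibbsState_sectorHamiltonianTT'_eq_toBlock (L : ℕ) (tp U n β : ℝ)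
    (X : Matrix (Finset (Orb (FermionTorus 2 L))) (Finset (Orb (FermionTorus 2 L))) ℂ) :
    gibbsState β (sectorHamiltonianTT' 1 tp U n L) (X.submatrix Subtype.val Subtype.val) =
      gibbsState β
        ((hubbardTorusTT' L 1 tp U).toBlock
          (fun s : Finset (Orb (FermionTorus 2 L)) =>
              s.card = 2 * ⌊(1 - (1 - n)) * (L : ℝ) ^ 2 / 2⌋₊ ∧
                2 * (s.filter fun i => (ofLex i).2 = 0).card = 2 * ⌊(1 - (1 - n)) * (L : ℝ) ^ 2 / 2⌋₊)
          (fun s : Finset (Orb (FermionTorus 2 L)) =>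
              s.card = 2 * ⌊(1 - (1 - n)) * (L : ℝ) ^ 2 / 2⌋₊ ∧
                2 * (s.filter fun i => (ofLex i).2 = 0).card = 2 * ⌊(1 - (1 - n)) * (L : ℝ) ^ 2 / 2⌋₊))
        (X.toBlock
          (fun s : Finset (Orb (FermionTorus 2 L)) =>
              s.card = 2 * ⌊(1 - (1 - n)) * (L : ℝ) ^ 2 / 2⌋₊ ∧
                2 * (s.filter fun i => (ofLex i).2 = 0).card = 2 * ⌊(1 - (1 - n)) * (L : ℝ) ^ 2 / 2⌋₊)
          (fun s : Finset (Orb (FermionTorus 2 L)) =>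
              s.card = 2 * ⌊(1 - (1 - n)) * (L : ℝ) ^ 2 / 2⌋₊ ∧
                2 * (s.filter fun i => (ofLex i).2 = 0).card = 2 * ⌊(1 - (1 - n)) * (L : ℝ) ^ 2 / 2⌋₊)) := by
  set e := Equiv.subtypeEquivRight (sectorPred_iff_szConfig n L) with he
  have hH : sectorHamiltonianTT' 1 tp U n L =
      reindex e e ((hubbardTorusTT' L 1 tp U).toBlock
          (fun s : Finset (Orb (FermionTorus 2 L)) =>
              s.card = 2 * ⌊(1 - (1 - n)) * (L : ℝ) ^ 2 / 2⌋₊ ∧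
                2 * (s.filter fun i => (ofLex i).2 = 0).card = 2 * ⌊(1 - (1 - n)) * (L : ℝ) ^ 2 / 2⌋₊)
          (fun s : Finset (Orb (FermionTorus 2 L)) =>
              s.card = 2 * ⌊(1 - (1 - n)) * (L : ℝ) ^ 2 / 2⌋₊ ∧
                2 * (s.filter fun i => (ofLex i).2 = 0).card = 2 * ⌊(1 - (1 - n)) * (L : ℝ) ^ 2 / 2⌋₊)) := by
    ext i j
    simp [sectorHamiltonianTT', he, Matrix.reindex_apply, Matrix.toBlock_apply]
  have hX : X.submatrix Subtype.val Subtype.val =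
      reindex e e (X.toBlock
          (fun s : Finset (Orb (FermionTorus 2 L)) =>
              s.card = 2 * ⌊(1 - (1 - n)) * (L : ℝ) ^ 2 / 2⌋₊ ∧
                2 * (s.filter fun i => (ofLex i).2 = 0).card = 2 * ⌊(1 - (1 - n)) * (L : ℝ) ^ 2 / 2⌋₊)
          (fun s : Finset (Orb (FermionTorus 2 L)) =>
              s.card = 2 * ⌊(1 - (1 - n)) * (L : ℝ) ^ 2 / 2⌋₊ ∧
                2 * (s.filter fun i => (ofLex i).2 = 0).card = 2 * ⌊(1 - (1 - n)) * (L : ℝ) ^ 2 / 2⌋₊)) := by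
    ext i j
    simp [he, Matrix.reindex_apply, Matrix.toBlock_apply]
  rw [hH, hX, gibbsState_reindex]

/-- **The `limsup` kinetic hook in hubbard-thermal's vocabulary**: if for every `ε > 0`, eventually in `L`, the Gibbs state of
`sectorHamiltonianTT' 1 t′ U n L` at `β` has `Re⟨kinOpTT' L t′|_szConfig⟩/(2L²) ≤ c + ε`, the single-temperature leaf holds at `β` with constant `c`.
[cite: ParamekantiTrivediRanderia1998, eq. (3) and §IV] -/
theorem ObsThermalStiffnessSeqCeilingAtBeta_of_sectorGibbs_kinetic_eventually_add {tp U n β : ℝ} (hβ : 0 < β) {c : ℚ}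
    (hkin : ∀ ε : ℝ, 0 < ε → ∀ᶠ L : ℕ in atTop, ∀ [NeZero L],
      (gibbsState β (sectorHamiltonianTT' 1 tp U n L)
          ((kinOpTT' L tp).submatrix Subtype.val Subtype.val)).re /
        (2 * (L : ℝ) ^ 2) ≤ ((c : ℚ) : ℝ) + ε) :
    ObsThermalStiffnessSeqCeilingAtBeta tp U n β c := by
  refine ObsThermalStiffnessSeqCeilingAtBeta_of_kinetic_eventually_add hβ fun ε hε => ?_
  filter_upwards [hkin ε hε] with L hL
  intro hL0
  have h := @hL hL0
  rwa [gibbsState_sectorHamiltonianTT'_eq_toBlock] at h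

/-- **The subsequence kinetic hook in hubbard-thermal's vocabulary**: every sequence of sides `L_j → ∞` has a subsequence along which, for every
`ε > 0`, eventually the Gibbs state of `sectorHamiltonianTT' 1 t′ U n L_{φ j}` at `β` has `Re⟨kinOpTT'|_szConfig⟩/(2L_{φ j}²) ≤ c + ε` ⇒ the leaf at `β`
with constant `c` (the shape mixture compactness + a torus-limit bound `Re ω(e₁-kinetic word per site) ≤ 2c` deliver). [cite: ParamekantiTrivediRanderia1998, eq. (3) and §IV] -/
theorem ObsThermalStiffnessSeqCeilingAtBeta_of_sectorGibbs_kinetic_subseq_add {tp U n β : ℝ} (hβ : 0 < β) {c : ℚ}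
    (hkin : ∀ Ls : ℕ → ℕ, Tendsto Ls atTop atTop → ∃ φ : ℕ → ℕ, StrictMono φ ∧ ∀ ε : ℝ, 0 < ε →
      ∀ᶠ j : ℕ in atTop, ∀ [NeZero (Ls (φ j))],
      (gibbsState β (sectorHamiltonianTT' 1 tp U n (Ls (φ j)))
          ((kinOpTT' (Ls (φ j)) tp).submatrix Subtype.val Subtype.val)).re /
        (2 * ((Ls (φ j) : ℕ) : ℝ) ^ 2) ≤ ((c : ℚ) : ℝ) + ε) :
    ObsThermalStiffnessSeqCeilingAtBeta tp U n β c := by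
  refine ObsThermalStiffnessSeqCeilingAtBeta_of_kinetic_subseq_add hβ fun Ls hLs => ?_
  obtain ⟨φ, hφ, hev⟩ := hkin Ls hLs
  refine ⟨φ, hφ, fun ε hε => ?_⟩
  filter_upwards [hev ε hε] with j hj
  intro hL0
  have h := @hj hL0
  rwa [gibbsState_sectorHamiltonianTT'_eq_toBlock] at h

namespace ThermalKTDictionaryAt

variable {tp U n : ℝ} {ρe : ℝ → ℝ} {Tc : ℝ}

/-- **ROUTE T-A in hubbard-thermal's vocabulary, `limsup` form**: `∀ ε > 0`, eventually in `L`,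
`Re⟨kinOpTT'|_szConfig⟩_{β, sectorHamiltonianTT'}/(2L²) ≤ c + ε`, and `(π/4)c < 1/β` ⇒ `Tc ≤ 1/β`. Monotonicity-free. [cite: HazraVermaRanderia2019, eqs. (2)–(4)] -/
theorem le_inv_of_sectorGibbs_kinetic_eventually_add (h : ThermalKTDictionaryAt tp U n ρe Tc) {β : ℝ} (hβ : 0 < β) {c : ℚ}
    (hkin : ∀ ε : ℝ, 0 < ε → ∀ᶠ L : ℕ in atTop, ∀ [NeZero L],
      (gibbsState β (sectorHamiltonianTT' 1 tp U n L)
          ((kinOpTT' L tp).submatrix Subtype.val Subtype.val)).re /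
        (2 * (L : ℝ) ^ 2) ≤ ((c : ℚ) : ℝ) + ε)
    (hlt : π / 4 * ((c : ℚ) : ℝ) < 1 / β) : Tc ≤ 1 / β :=
  h.le_inv_of_leafAtBeta hβ (ObsThermalStiffnessSeqCeilingAtBeta_of_sectorGibbs_kinetic_eventually_add hβ hkin) hlt

/-- **ROUTE T-A in hubbard-thermal's vocabulary, subsequence form** ⇒ `Tc ≤ 1/β` under `(π/4)c < 1/β`. [cite: HazraVermaRanderia2019, eqs. (2)–(4)] -/
theorem le_inv_of_sectorGibbs_kinetic_subseq_add (h : ThermalKTDictionaryAt tp U n ρe Tc) {β : ℝ} (hβ : 0 < β) {c : ℚ}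
    (hkin : ∀ Ls : ℕ → ℕ, Tendsto Ls atTop atTop → ∃ φ : ℕ → ℕ, StrictMono φ ∧ ∀ ε : ℝ, 0 < ε →
      ∀ᶠ j : ℕ in atTop, ∀ [NeZero (Ls (φ j))],
      (gibbsState β (sectorHamiltonianTT' 1 tp U n (Ls (φ j)))
          ((kinOpTT' (Ls (φ j)) tp).submatrix Subtype.val Subtype.val)).re /
        (2 * ((Ls (φ j) : ℕ) : ℝ) ^ 2) ≤ ((c : ℚ) : ℝ) + ε)
    (hlt : π / 4 * ((c : ℚ) : ℝ) < 1 / β) : Tc ≤ 1 / β :=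
  h.le_inv_of_leafAtBeta hβ (ObsThermalStiffnessSeqCeilingAtBeta_of_sectorGibbs_kinetic_subseq_add hβ hkin) hlt

/-- **Row form at `(8, ⅞, 0)`, `β = 4`, in hubbard-thermal's vocabulary** (the cell's crux №3 target «T_KT ≤ t/4», monotonicity-free): if for every
`ε > 0`, for all large `L`, the Gibbs state of `sectorHamiltonianTT' 1 0 8 (7/8) L` at `β = 4` has `Re⟨kinOpTT' L 0|_szConfig⟩/(2L²) ≤ c + ε` with
`c < 0.3183098` (`limsup ⟨−k_x⟩ ≤ 2c < 0.6366196` per site), then `Tc ≤ 1/4`. [cite: HazraVermaRanderia2019, eqs. (2)–(4)] -/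
theorem le_quarter_of_sectorGibbs_kinetic_eventually_add_four {ρe : ℝ → ℝ} {Tc : ℝ} (h : ThermalKTDictionaryAt 0 8 (7 / 8) ρe Tc)
    {c : ℚ}
    (hkin : ∀ ε : ℝ, 0 < ε → ∀ᶠ L : ℕ in atTop, ∀ [NeZero L],
      (gibbsState 4 (sectorHamiltonianTT' 1 0 8 (7 / 8) L)
          ((kinOpTT' L 0).submatrix Subtype.val Subtype.val)).re /
        (2 * (L : ℝ) ^ 2) ≤ ((c : ℚ) : ℝ) + ε)
    (hc : ((c : ℚ) : ℝ) < 0.3183098) : Tc ≤ 1 / 4 :=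
  h.le_quarter_of_leafAtBeta_four (ObsThermalStiffnessSeqCeilingAtBeta_of_sectorGibbs_kinetic_eventually_add (by norm_num) hkin) hc

end ThermalKTDictionaryAt

/-! ## The eigen-mixture form (hubbard-thermal's most primitive finite-volume object)

`TorusSectorGibbsMixture` presents the canonical Gibbs state as the MIXTURE `(p_{L,i}, ψ_{L,i})` of an orthonormal eigenbasis of the
sector with Boltzmann weights (`sectorGibbsWeightTT'`, `sectorGibbsVectorTT'`); its torus limits are limits of the mixture averages
`Σ_i p_{L,i} Re⟨ψ_{L,i}, X ψ_{L,i}⟩`. The tree already identifies the mixture average of ANY torus observable with the `gibbsState` of the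
compression — `TorusSectorGibbsScaleCovariance.sum_sectorGibbsWeightTT'_mul_expect_eq_gibbsState` (REUSED; eigen-mixture = trace against
`Z⁻¹e^{−βH|_p}`) — so the kinetic hook also accepts the mixture form directly (`sum_sectorGibbsWeightTT'_mul_re_expect_kinOp_eq`,
`ObsThermalStiffnessSeqCeilingAtBeta_of_sectorGibbsMixture_kinetic_eventually_add / _subseq_add` and the closures). What then remains on the
producer side is mixture compactness (A) alone: a torus-limit bound `Re ω(e₁-kinetic word per site) ≤ 2c` for every torus limit of the
sector Gibbs mixtures ⇒ (compactness) the subsequence hypothesis below.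
-/

/-- **Real form for the `e₁`-kinetic word**: the mixture average `Σ_i p_{L,i} Re⟨ψ_{L,i}, kinOpTT' L t′ ψ_{L,i}⟩` is the real part of the Gibbs
expectation of `kinOpTT' L t′|_szConfig` in the state of `sectorHamiltonianTT' 1 t′ U n L`. [cite: Israel1979, §I.3 eq. (26)] -/
theorem sum_sectorGibbsWeightTT'_mul_re_expect_kinOp_eq (β tp U n : ℝ) (L : ℕ) [NeZero L] :
    ∑ i, sectorGibbsWeightTT' β 1 tp U n L i * (expect (kinOpTT' L tp) (sectorGibbsVectorTT' 1 tp U n L i)).re =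
      (gibbsState β (sectorHamiltonianTT' 1 tp U n L) ((kinOpTT' L tp).submatrix Subtype.val Subtype.val)).re := by
  rw [← sum_sectorGibbsWeightTT'_mul_expect_eq_gibbsState, Complex.re_sum]
  refine Finset.sum_congr rfl fun i _ => ?_
  rw [Complex.re_ofReal_mul]

/-- **The `limsup` kinetic hook on the MIXTURE average**: if for every `ε > 0`, eventually in `L`,
`Σ_i p_{L,i}(β) Re⟨ψ_{L,i}, kinOpTT' L t′ ψ_{L,i}⟩/(2L²) ≤ c + ε` for the canonical Gibbs mixture of `hubbardTorusTT' L 1 t′ U` on `szConfig n L`, the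
single-temperature leaf holds at `β` with constant `c`. [cite: ParamekantiTrivediRanderia1998, eq. (3) and §IV] -/
theorem ObsThermalStiffnessSeqCeilingAtBeta_of_sectorGibbsMixture_kinetic_eventually_add {tp U n β : ℝ} (hβ : 0 < β) {c : ℚ}
    (hkin : ∀ ε : ℝ, 0 < ε → ∀ᶠ L : ℕ in atTop, ∀ [NeZero L],
      (∑ i, sectorGibbsWeightTT' β 1 tp U n L i *
            (expect (kinOpTT' L tp) (sectorGibbsVectorTT' 1 tp U n L i)).re) /
        (2 * (L : ℝ) ^ 2) ≤ ((c : ℚ) : ℝ) + ε) :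
    ObsThermalStiffnessSeqCeilingAtBeta tp U n β c := by
  refine ObsThermalStiffnessSeqCeilingAtBeta_of_sectorGibbs_kinetic_eventually_add hβ fun ε hε => ?_
  filter_upwards [hkin ε hε] with L hL
  intro hL0
  have h := @hL hL0
  rwa [sum_sectorGibbsWeightTT'_mul_re_expect_kinOp_eq] at h

/-- **The subsequence kinetic hook on the MIXTURE average** (the shape mixture compactness + a torus-limit bound deliver).
[cite: ParamekantiTrivediRanderia1998, eq. (3) and §IV] -/
theorem ObsThermalStiffnessSeqCeilingAtBeta_of_sectorGibbsMixture_kinetic_subseq_add {tp U n β : ℝ} (hβ : 0 < β) {c : ℚ}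
    (hkin : ∀ Ls : ℕ → ℕ, Tendsto Ls atTop atTop → ∃ φ : ℕ → ℕ, StrictMono φ ∧ ∀ ε : ℝ, 0 < ε →
      ∀ᶠ j : ℕ in atTop, ∀ [NeZero (Ls (φ j))],
      (∑ i, sectorGibbsWeightTT' β 1 tp U n (Ls (φ j)) i *
            (expect (kinOpTT' (Ls (φ j)) tp) (sectorGibbsVectorTT' 1 tp U n (Ls (φ j)) i)).re) /
        (2 * ((Ls (φ j) : ℕ) : ℝ) ^ 2) ≤ ((c : ℚ) : ℝ) + ε) :
    ObsThermalStiffnessSeqCeilingAtBeta tp U n β c := by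
  refine ObsThermalStiffnessSeqCeilingAtBeta_of_sectorGibbs_kinetic_subseq_add hβ fun Ls hLs => ?_
  obtain ⟨φ, hφ, hev⟩ := hkin Ls hLs
  refine ⟨φ, hφ, fun ε hε => ?_⟩
  filter_upwards [hev ε hε] with j hj
  intro hL0
  have h := @hj hL0
  rwa [sum_sectorGibbsWeightTT'_mul_re_expect_kinOp_eq] at h

namespace ThermalKTDictionaryAt

variable {tp U n : ℝ} {ρe : ℝ → ℝ} {Tc : ℝ}

/-- **ROUTE T-A on the mixture average, `limsup` form** ⇒ `Tc ≤ 1/β` under `(π/4)c < 1/β`. Monotonicity-free.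
[cite: HazraVermaRanderia2019, eqs. (2)–(4)] -/
theorem le_inv_of_sectorGibbsMixture_kinetic_eventually_add (h : ThermalKTDictionaryAt tp U n ρe Tc) {β : ℝ} (hβ : 0 < β) {c : ℚ}
    (hkin : ∀ ε : ℝ, 0 < ε → ∀ᶠ L : ℕ in atTop, ∀ [NeZero L],
      (∑ i, sectorGibbsWeightTT' β 1 tp U n L i *
            (expect (kinOpTT' L tp) (sectorGibbsVectorTT' 1 tp U n L i)).re) /
        (2 * (L : ℝ) ^ 2) ≤ ((c : ℚ) : ℝ) + ε)
    (hlt : π / 4 * ((c : ℚ) : ℝ) < 1 / β) : Tc ≤ 1 / β :=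
  h.le_inv_of_leafAtBeta hβ (ObsThermalStiffnessSeqCeilingAtBeta_of_sectorGibbsMixture_kinetic_eventually_add hβ hkin) hlt

/-- **ROUTE T-A on the mixture average, subsequence form** ⇒ `Tc ≤ 1/β` under `(π/4)c < 1/β`. [cite: HazraVermaRanderia2019, eqs. (2)–(4)] -/
theorem le_inv_of_sectorGibbsMixture_kinetic_subseq_add (h : ThermalKTDictionaryAt tp U n ρe Tc) {β : ℝ} (hβ : 0 < β) {c : ℚ}
    (hkin : ∀ Ls : ℕ → ℕ, Tendsto Ls atTop atTop → ∃ φ : ℕ → ℕ, StrictMono φ ∧ ∀ ε : ℝ, 0 < ε →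
      ∀ᶠ j : ℕ in atTop, ∀ [NeZero (Ls (φ j))],
      (∑ i, sectorGibbsWeightTT' β 1 tp U n (Ls (φ j)) i *
            (expect (kinOpTT' (Ls (φ j)) tp) (sectorGibbsVectorTT' 1 tp U n (Ls (φ j)) i)).re) /
        (2 * ((Ls (φ j) : ℕ) : ℝ) ^ 2) ≤ ((c : ℚ) : ℝ) + ε)
    (hlt : π / 4 * ((c : ℚ) : ℝ) < 1 / β) : Tc ≤ 1 / β :=
  h.le_inv_of_leafAtBeta hβ (ObsThermalStiffnessSeqCeilingAtBeta_of_sectorGibbsMixture_kinetic_subseq_add hβ hkin) hlt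

/-- **Row form at `(8, ⅞, 0)`, `β = 4`, on the mixture average** («T_KT ≤ t/4», monotonicity-free): `∀ ε > 0`, eventually in `L`,
`Σ_i p_{L,i}(4) Re⟨ψ_{L,i}, kinOpTT' L 0 ψ_{L,i}⟩/(2L²) ≤ c + ε` with `c < 0.3183098` ⇒ `Tc ≤ 1/4`. [cite: HazraVermaRanderia2019, eqs. (2)–(4)] -/
theorem le_quarter_of_sectorGibbsMixture_kinetic_eventually_add_four {ρe : ℝ → ℝ} {Tc : ℝ} (h : ThermalKTDictionaryAt 0 8 (7 / 8) ρe Tc)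
    {c : ℚ}
    (hkin : ∀ ε : ℝ, 0 < ε → ∀ᶠ L : ℕ in atTop, ∀ [NeZero L],
      (∑ i, sectorGibbsWeightTT' 4 1 0 8 (7 / 8) L i *
            (expect (kinOpTT' L 0) (sectorGibbsVectorTT' 1 0 8 (7 / 8) L i)).re) /
        (2 * (L : ℝ) ^ 2) ≤ ((c : ℚ) : ℝ) + ε)
    (hc : ((c : ℚ) : ℝ) < 0.3183098) : Tc ≤ 1 / 4 :=
  h.le_quarter_of_leafAtBeta_four (ObsThermalStiffnessSeqCeilingAtBeta_of_sectorGibbsMixture_kinetic_eventually_add (by norm_num) hkin) hc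

end ThermalKTDictionaryAt

/-! ## The TORUS-LIMIT form: exactly what a `T > 0` certificate reader delivers

hubbard-thermal's reader (`IsTorusLimitOfMixture.re_expect_ge_of_thermal_certificate_symm_TT'_of_sectorGibbs`) turns one thermal certificate
into a bound `Re ω(W) ≤ c` on a local word `W` for EVERY torus limit `ω` (`InfVolFermionState.IsTorusLimitOfMixture`) of the canonical sector
Gibbs mixtures at `β`. Mixture compactness is in the tree (`exists_isTorusLimitOfMixture_sectorGibbs_subseq`, TorusLimitOfMixturesCompactness):
every `Ls → ∞` has a subsequence with a torus limit. So the subsequence hook above closes as soon as the word `W` is identified with the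
`e₁`-kinetic word: `Re⟨ψ, kinOpTT' L t′ ψ⟩/(2L²) = Re (torusAvgExpect L Λ W ψ)` for every torus vector `ψ` (W = half the translation-averaged
`e₁` f-sum word — an operator identity, the certifier's bookkeeping for its chosen objective). `ObsThermalStiffnessSeqCeilingAtBeta_of_torusLimit_kinetic_bound`
takes exactly these two inputs; the closures give `Tc ≤ 1/β` and the `(8, ⅞, 0)`, `β = 4` row.
-/

/-- **Torus-limit kinetic bound ⇒ the single-temperature leaf** (anchor `(U, n, t′)`, `0 ≤ n ≤ 2`, `β > 0`). Inputs: (W1) a local word `W`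
on a finite window `Λ ⊂ ℤ²` whose translation average reads the `e₁`-kinetic word, `Re⟨ψ, kinOpTT' L t′ ψ⟩/(2L²) = Re torusAvgExpect L Λ W ψ`
for every torus vector `ψ`; (W2) for EVERY infinite-volume state `ω` that is a torus limit of the canonical sector Gibbs mixtures of
`hubbardTorusTT' · 1 t′ U` at `β` along some `Ls → ∞`: `Re ω(W) ≤ c`. Conclusion: `ObsThermalStiffnessSeqCeilingAtBeta tp U n β c`.
Proof: compactness (`exists_isTorusLimitOfMixture_sectorGibbs_subseq`) extracts from any `Ls → ∞` a subsequence with a torus limit `ω`;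
along it the mixture averages of `W` tend to `ω(W)`, whose real part is `≤ c`, so they are eventually `≤ c + ε`; (W1) turns them into the
kinetic mixture averages of `ObsThermalStiffnessSeqCeilingAtBeta_of_sectorGibbsMixture_kinetic_subseq_add`.
[cite: ParamekantiTrivediRanderia1998, eq. (3) and §IV] [cite: BratteliRobinsonI1987, Thm. 2.3.15] -/
theorem ObsThermalStiffnessSeqCeilingAtBeta_of_torusLimit_kinetic_bound {tp U n β : ℝ} (hβ : 0 < β) (hn0 : 0 ≤ n) (hn2 : n ≤ 2)
    {c : ℚ} {Λ : Finset (Literature.Probability.LatticeModels.Site 2)} (W : FermionOp Λ)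
    (hW : ∀ (L : ℕ) [NeZero L] (ψ : Fock (Orb (FermionTorus 2 L))),
      (expect (kinOpTT' L tp) ψ).re / (2 * (L : ℝ) ^ 2) = (torusAvgExpect L Λ W ψ).re)
    (hcert : ∀ (ω : InfVolFermionState 2) (Ls : ℕ → ℕ), Tendsto Ls atTop atTop →
      ω.IsTorusLimitOfMixture (sectorGibbsCount n) (fun L => sectorGibbsWeightTT' β 1 tp U n L)
        (fun L => sectorGibbsVectorTT' 1 tp U n L) Ls → (ω.expect Λ W).re ≤ ((c : ℚ) : ℝ)) :
    ObsThermalStiffnessSeqCeilingAtBeta tp U n β c := by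
  refine ObsThermalStiffnessSeqCeilingAtBeta_of_sectorGibbsMixture_kinetic_subseq_add hβ fun Ls hLs => ?_
  obtain ⟨φ, hφ, ω, hω⟩ := exists_isTorusLimitOfMixture_sectorGibbs_subseq 1 tp U hn0 hn2 β hLs
  refine ⟨φ, hφ, fun ε hε => ?_⟩
  have hωc : (ω.expect Λ W).re ≤ ((c : ℚ) : ℝ) := hcert ω (Ls ∘ φ) (hLs.comp hφ.tendsto_atTop) hω
  -- along the subsequence the mixture averages of `W` tend to `ω(W)`
  have hlim : Tendsto (fun j => ∑ i, (sectorGibbsWeightTT' β 1 tp U n (Ls (φ j)) i : ℂ) *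
      torusAvgExpect (Ls (φ j)) Λ W (sectorGibbsVectorTT' 1 tp U n (Ls (φ j)) i)) atTop (𝓝 (ω.expect Λ W)) := hω Λ W
  have hlimre := (Complex.continuous_re.tendsto _).comp hlim
  have hev : ∀ᶠ j in atTop, (∑ i, (sectorGibbsWeightTT' β 1 tp U n (Ls (φ j)) i : ℂ) *
      torusAvgExpect (Ls (φ j)) Λ W (sectorGibbsVectorTT' 1 tp U n (Ls (φ j)) i)).re < ((c : ℚ) : ℝ) + ε :=
    (tendsto_order.1 hlimre).2 _ (by linarith)
  filter_upwards [hev] with j hj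
  intro hL0
  have hsum : (∑ i, sectorGibbsWeightTT' β 1 tp U n (Ls (φ j)) i *
        (expect (kinOpTT' (Ls (φ j)) tp) (sectorGibbsVectorTT' 1 tp U n (Ls (φ j)) i)).re) /
        (2 * ((Ls (φ j) : ℕ) : ℝ) ^ 2) =
      ∑ i, sectorGibbsWeightTT' β 1 tp U n (Ls (φ j)) i *
        (torusAvgExpect (Ls (φ j)) Λ W (sectorGibbsVectorTT' 1 tp U n (Ls (φ j)) i)).re := by
    rw [Finset.sum_div]
    refine Finset.sum_congr rfl fun i _ => ?_
    rw [mul_div_assoc, hW]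
  have hre : (∑ i, (sectorGibbsWeightTT' β 1 tp U n (Ls (φ j)) i : ℂ) *
        torusAvgExpect (Ls (φ j)) Λ W (sectorGibbsVectorTT' 1 tp U n (Ls (φ j)) i)).re =
      ∑ i, sectorGibbsWeightTT' β 1 tp U n (Ls (φ j)) i *
        (torusAvgExpect (Ls (φ j)) Λ W (sectorGibbsVectorTT' 1 tp U n (Ls (φ j)) i)).re := by
    rw [Complex.re_sum]
    refine Finset.sum_congr rfl fun i _ => ?_
    rw [Complex.re_ofReal_mul]
  rw [hsum, ← hre]
  exact hj.le

namespace ThermalKTDictionaryAt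

variable {tp U n : ℝ} {ρe : ℝ → ℝ} {Tc : ℝ}

/-- **ROUTE T-A, torus-limit form: one word identity + a certificate-type bound `Re ω(W) ≤ c` on every thermal torus limit at `β`, and
`(π/4)c < 1/β` ⇒ `Tc ≤ 1/β`.** Monotonicity-free (dictionary = K2 stability + K1t identification).
[cite: HazraVermaRanderia2019, eqs. (2)–(4)] -/
theorem le_inv_of_torusLimit_kinetic_bound (h : ThermalKTDictionaryAt tp U n ρe Tc) {β : ℝ} (hβ : 0 < β) (hn0 : 0 ≤ n) (hn2 : n ≤ 2)
    {c : ℚ} {Λ : Finset (Literature.Probability.LatticeModels.Site 2)} (W : FermionOp Λ)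
    (hW : ∀ (L : ℕ) [NeZero L] (ψ : Fock (Orb (FermionTorus 2 L))),
      (expect (kinOpTT' L tp) ψ).re / (2 * (L : ℝ) ^ 2) = (torusAvgExpect L Λ W ψ).re)
    (hcert : ∀ (ω : InfVolFermionState 2) (Ls : ℕ → ℕ), Tendsto Ls atTop atTop →
      ω.IsTorusLimitOfMixture (sectorGibbsCount n) (fun L => sectorGibbsWeightTT' β 1 tp U n L)
        (fun L => sectorGibbsVectorTT' 1 tp U n L) Ls → (ω.expect Λ W).re ≤ ((c : ℚ) : ℝ))
    (hlt : π / 4 * ((c : ℚ) : ℝ) < 1 / β) : Tc ≤ 1 / β :=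
  h.le_inv_of_leafAtBeta hβ (ObsThermalStiffnessSeqCeilingAtBeta_of_torusLimit_kinetic_bound hβ hn0 hn2 W hW hcert) hlt

/-- **Row form at `(8, ⅞, 0)`, `β = 4`, torus-limit version** (the cell's crux №3 target «T_KT ≤ t/4»): a word `W` reading the `e₁`-kinetic
word (`t′ = 0`), and `Re ω(W) ≤ c` with `c < 0.3183098` for every torus limit `ω` of the canonical Gibbs mixtures of `hubbardTorusTT' L 1 0 8`
on `szConfig (7/8) L` at `β = 4`, give `Tc ≤ 1/4` for every profile obeying the thermal KT dictionary at `(8, ⅞, 0)`.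
[cite: HazraVermaRanderia2019, eqs. (2)–(4)] -/
theorem le_quarter_of_torusLimit_kinetic_bound_four {ρe : ℝ → ℝ} {Tc : ℝ} (h : ThermalKTDictionaryAt 0 8 (7 / 8) ρe Tc)
    {c : ℚ} {Λ : Finset (Literature.Probability.LatticeModels.Site 2)} (W : FermionOp Λ)
    (hW : ∀ (L : ℕ) [NeZero L] (ψ : Fock (Orb (FermionTorus 2 L))),
      (expect (kinOpTT' L 0) ψ).re / (2 * (L : ℝ) ^ 2) = (torusAvgExpect L Λ W ψ).re)
    (hcert : ∀ (ω : InfVolFermionState 2) (Ls : ℕ → ℕ), Tendsto Ls atTop atTop →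
      ω.IsTorusLimitOfMixture (sectorGibbsCount (7 / 8)) (fun L => sectorGibbsWeightTT' 4 1 0 8 (7 / 8) L)
        (fun L => sectorGibbsVectorTT' 1 0 8 (7 / 8) L) Ls → (ω.expect Λ W).re ≤ ((c : ℚ) : ℝ))
    (hc : ((c : ℚ) : ℝ) < 0.3183098) : Tc ≤ 1 / 4 :=
  h.le_quarter_of_leafAtBeta_four
    (ObsThermalStiffnessSeqCeilingAtBeta_of_torusLimit_kinetic_bound (by norm_num) (by norm_num) (by norm_num) W hW hcert) hc

end ThermalKTDictionaryAt

end Summit.Ventures.CertifiedManyBodySolver.Observables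

end
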